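import Mathlib
import Summits.Ventures.PercRepro2.SLevelCD
import Summits.Ventures.PercRepro2.SLevelCDLeaf
import Summits.Ventures.PercRepro2.StarPattern

/-!
# The two-root class of (CD), part 1: the definitions and the double-pinning lemmas (blind cell PercRepro2,
mine-c g12; the theorem `cd_of_two_root` is in `SLevelCDTwoRoot.lean`)

Let `e₁ = {a₁, a₃}`, `e₂ = {a₂, a₃}` be the only edges at `a₃` (`IsTwoRootAt`), `o ≠ a₃`. Under
`Q = {a₁ ↮ a₂}` the pair `(e₁, e₂)` is never `(open, open)`, case 1 is `(open, closed)`, `PD` is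
`(closed, closed)`, and every connection event among the other vertices sees the configuration with both
edges closed (`StarPattern.conn_update_false_pendant`). Then for every increasing `F`,
  `covS F φ = a c q′ · [ (1 − p₁p₂)(q′X − ZY) − (1 − p₁) M₁ (Y − Y⁰) ]`
with `a = p₁(1−p₂)`, `c = (1−p₁)(1−p₂)`, `q′ = P(Q)` of the base world, `X, Y` the case-1 expectations,
`Y⁰` the base one, `Z = P(Q, o∈C₂)`, `M₁ = P(Q, o∈C₁)`; `q′X ≤ ZY` is BHK06 Thm 1.4 (functional) in the
case-1 world and `Y⁰ ≤ Y` is the monotonicity of `F` — so `covS F φ ≤ 0`: **`cd_of_two_root`**.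
The leaf class `cd_of_leaf` (SLevelCDLeaf.lean) is the case `p₂ = 0`. Nothing beyond is claimed. -/

namespace Summit.Ventures.PercRepro2

open UnionCluster

namespace SLevel

section TwoRoot

variable {V : Type*} {E : Type*} [Fintype E] [DecidableEq E] [Fintype V] [DecidableEq V]
  {R : Type*} [Field R] [LinearOrder R] [IsStrictOrderedRing R]

/-- `a₃` is adjacent only to the two roots: `e₁ = {a₁,a₃}`, `e₂ = {a₂,a₃}` are its only edges. -/
structure IsTwoRootAt (ends : E → Sym2 V) (a₁ a₂ a₃ : V) (e₁ e₂ : E) : Prop where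
  /-- the edge to `a₁` -/
  ends₁ : ends e₁ = s(a₁, a₃)
  /-- the edge to `a₂` -/
  ends₂ : ends e₂ = s(a₂, a₃)
  /-- two different edges -/
  ne : e₁ ≠ e₂
  /-- no other edge at `a₃` -/
  unique : ∀ e, a₃ ∈ ends e → e = e₁ ∨ e = e₂
  /-- `a₃` is not a root -/
  ne₁ : a₁ ≠ a₃
  /-- `a₃` is not a root -/
  ne₂ : a₂ ≠ a₃

variable (p : E → R) (ends : E → Sym2 V) (o a₁ a₂ a₃ : V) (e₁ e₂ : E)

local notation3 "Q" => avoidAll ends a₂ {a₁}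
local notation3 "𝟙Q" => (avoidAll ends a₂ {a₁}).indicator (1 : Config E → R)
local notation3 "𝟙e" => (connEvent ends a₁ a₃).indicator (1 : Config E → R)
local notation3 "𝟙f" => (connEvent ends a₂ o).indicator (1 : Config E → R)
local notation3 "𝟙o₁" => (connEvent ends a₁ o).indicator (1 : Config E → R)
local notation3 "D" => prob p (PDEvent ends a₁ a₂ a₃)
local notation3 "Dₒ" => CovForm.Do p ends o a₁ a₂ a₃

/-- The configuration with both root edges of `a₃` closed. -/
def base (ω : Config E) : Config E := Function.update (Function.update ω e₂ false) e₁ false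

/-- The configuration with the states `(b₁, b₂)` on `(e₁, e₂)`. -/
def upd (b₁ b₂ : Bool) (ω : Config E) : Config E := Function.update (Function.update ω e₂ b₂) e₁ b₁

variable {ends a₁ a₂ a₃ e₁ e₂}

omit [Fintype E] [Fintype V] [DecidableEq V] in
/-- With `e₂` closed, a connection between vertices `≠ a₃` ignores `e₁`. -/
lemma conn_iff_update₁ (h : IsTwoRootAt ends a₁ a₂ a₃ e₁ e₂) {ω : Config E} (hω : ω e₂ = false)
    {u v : V} (hu : u ≠ a₃) (hv : v ≠ a₃) :
    Conn ends ω u v ↔ Conn ends (Function.update ω e₁ false) u v :=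
  StarPattern.conn_update_false_pendant (by rw [h.ends₁, Sym2.eq_swap]) h.ne₁.symm
    (fun g hg hg3 => by
      rcases h.unique g hg3 with rfl | rfl
      · exact absurd rfl hg
      · exact Or.inr hω) hu hv

omit [Fintype E] [Fintype V] [DecidableEq V] in
/-- With `e₁` closed, a connection between vertices `≠ a₃` ignores `e₂`. -/
lemma conn_iff_update₂ (h : IsTwoRootAt ends a₁ a₂ a₃ e₁ e₂) {ω : Config E} (hω : ω e₁ = false)
    {u v : V} (hu : u ≠ a₃) (hv : v ≠ a₃) :
    Conn ends ω u v ↔ Conn ends (Function.update ω e₂ false) u v :=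
  StarPattern.conn_update_false_pendant (by rw [h.ends₂, Sym2.eq_swap]) h.ne₂.symm
    (fun g hg hg3 => by
      rcases h.unique g hg3 with rfl | rfl
      · exact Or.inr hω
      · exact absurd rfl hg) hu hv

omit [Fintype E] [Fintype V] [DecidableEq V] in
/-- `upd false false = base`. -/
lemma upd_ff (ω : Config E) : upd e₁ e₂ false false ω = base e₁ e₂ ω := rfl

omit [Fintype E] [Fintype V] [DecidableEq V] in
/-- Connections among vertices `≠ a₃` in `upd true false ω` are those of `base ω`. -/
lemma conn_upd_tf (h : IsTwoRootAt ends a₁ a₂ a₃ e₁ e₂) (ω : Config E) {u v : V} (hu : u ≠ a₃)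
    (hv : v ≠ a₃) : Conn ends (upd e₁ e₂ true false ω) u v ↔ Conn ends (base e₁ e₂ ω) u v := by
  have hω : upd e₁ e₂ true false ω e₂ = false := by
    simp [upd, Function.update_of_ne h.ne.symm]
  rw [conn_iff_update₁ h hω hu hv]
  simp only [upd, base, Function.update_idem]

omit [Fintype E] [Fintype V] [DecidableEq V] in
/-- Connections among vertices `≠ a₃` in `upd false true ω` are those of `base ω`. -/
lemma conn_upd_ft (h : IsTwoRootAt ends a₁ a₂ a₃ e₁ e₂) (ω : Config E) {u v : V} (hu : u ≠ a₃)
    (hv : v ≠ a₃) : Conn ends (upd e₁ e₂ false true ω) u v ↔ Conn ends (base e₁ e₂ ω) u v := by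
  have hω : upd e₁ e₂ false true ω e₁ = false := by simp [upd]
  rw [conn_iff_update₂ h hω hu hv]
  simp only [upd, base]
  rw [Function.update_comm h.ne, Function.update_idem, Function.update_comm h.ne.symm]

omit [Fintype E] [Fintype V] [DecidableEq V] in
/-- In the base configuration `a₃` is isolated. -/
lemma eq_of_conn_base (h : IsTwoRootAt ends a₁ a₂ a₃ e₁ e₂) (ω : Config E) {x : V}
    (hx : Conn ends (base e₁ e₂ ω) a₃ x) : x = a₃ := by
  have hS : ∀ y ∈ ({a₃} : Set V), ∀ z, (openGraph ends (base e₁ e₂ ω)).Adj y z → z ∈ ({a₃} : Set V) := by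
    intro y hy z hadj
    rw [Set.mem_singleton_iff] at hy
    rw [hy] at hadj
    obtain ⟨-, g, hg, hge⟩ := openGraph_adj.1 hadj
    have h3 : a₃ ∈ ends g := by rw [hge]; exact Sym2.mem_mk_left _ _
    rcases h.unique g h3 with rfl | rfl
    · simp [base] at hg
    · simp [base, Function.update_of_ne h.ne.symm] at hg
  exact Set.mem_singleton_iff.1 (mem_of_conn_of_closed hS (Set.mem_singleton a₃) hx)

omit [Fintype E] [Fintype V] [DecidableEq V] in
/-- With both root edges open, `a₁ ↔ a₂`. -/
lemma conn_upd_tt (h : IsTwoRootAt ends a₁ a₂ a₃ e₁ e₂) (ω : Config E) :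
    Conn ends (upd e₁ e₂ true true ω) a₁ a₂ := by
  have h1 : OpenAdj ends (upd e₁ e₂ true true ω) a₁ a₃ := ⟨e₁, by simp [upd], h.ends₁⟩
  have h2 : OpenAdj ends (upd e₁ e₂ true true ω) a₃ a₂ :=
    ⟨e₂, by simp [upd, Function.update_of_ne h.ne.symm], by rw [h.ends₂, Sym2.eq_swap]⟩
  exact conn_trans (conn_of_openAdj h1) (conn_of_openAdj h2)

omit [Fintype E] [Fintype V] [DecidableEq V] in
/-- With `e₁` open, `a₁ ↔ a₃`. -/
lemma conn_upd_tf_a₁a₃ (h : IsTwoRootAt ends a₁ a₂ a₃ e₁ e₂) (ω : Config E) :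
    Conn ends (upd e₁ e₂ true false ω) a₁ a₃ :=
  conn_of_openAdj ⟨e₁, by simp [upd], h.ends₁⟩

omit [Fintype E] [Fintype V] [DecidableEq V] in
/-- With `e₂` open and `e₁` closed, `a₁ ↔ a₃` forces `a₁ ↔ a₂`. -/
lemma conn_a₁a₂_of_upd_ft (h : IsTwoRootAt ends a₁ a₂ a₃ e₁ e₂) (ω : Config E)
    (hc : Conn ends (upd e₁ e₂ false true ω) a₁ a₃) : Conn ends (upd e₁ e₂ false true ω) a₁ a₂ :=
  conn_trans hc (conn_of_openAdj
    ⟨e₂, by simp [upd, Function.update_of_ne h.ne.symm], by rw [h.ends₂, Sym2.eq_swap]⟩)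

omit [Fintype E] [Fintype V] [DecidableEq V] in
/-- Under the two-root hypothesis `PD = Q ∩ {e₁ closed} ∩ {e₂ closed}`. -/
lemma PDEvent_eq_two_root (h : IsTwoRootAt ends a₁ a₂ a₃ e₁ e₂) :
    PDEvent ends a₁ a₂ a₃ = Q ∩ closedEdge e₁ ∩ closedEdge e₂ := by
  ext ω
  simp only [PDEvent, Dtilde, Set.mem_inter_iff, Set.mem_compl_iff, mem_connEvent, mem_inU,
    mem_avoidAll, Finset.mem_singleton, forall_eq, closedEdge, Set.mem_setOf_eq]
  constructor
  · rintro ⟨hQ, hU⟩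
    refine ⟨⟨fun hc => hQ (conn_symm hc), ?_⟩, ?_⟩
    · by_contra hc
      simp only [Bool.not_eq_false] at hc
      exact hU (Or.inl (conn_symm (conn_of_openAdj ⟨e₁, hc, h.ends₁⟩)))
    · by_contra hc
      simp only [Bool.not_eq_false] at hc
      exact hU (Or.inr (conn_symm (conn_of_openAdj ⟨e₂, hc, h.ends₂⟩)))
  · rintro ⟨⟨hQ, h1⟩, h2⟩
    refine ⟨fun hc => hQ (conn_symm hc), ?_⟩
    have hb : base e₁ e₂ ω = ω := by
      simp only [base]
      funext g
      by_cases hg1 : g = e₁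
      · subst hg1; simp [h1]
      · by_cases hg2 : g = e₂
        · subst hg2; simp [Function.update_of_ne h.ne.symm, h2]
        · simp [Function.update_of_ne hg1, Function.update_of_ne hg2]
    rintro (hc | hc)
    · rw [← hb] at hc
      exact h.ne₁ (eq_of_conn_base h ω hc)
    · rw [← hb] at hc
      exact h.ne₂ (eq_of_conn_base h ω hc)

omit [Fintype V] [DecidableEq V] [LinearOrder R] [IsStrictOrderedRing R] in
/-- The double pinning identity. -/
lemma expect_split2 (g : Config E → R) :
    expect p g = p e₁ * p e₂ * expect p (fun ω => g (upd e₁ e₂ true true ω)) +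
      p e₁ * (1 - p e₂) * expect p (fun ω => g (upd e₁ e₂ true false ω)) +
      (1 - p e₁) * p e₂ * expect p (fun ω => g (upd e₁ e₂ false true ω)) +
      (1 - p e₁) * (1 - p e₂) * expect p (fun ω => g (upd e₁ e₂ false false ω)) := by
  rw [expect_eq_pin p g e₁, expect_update_one, expect_update_zero,
    expect_eq_pin p (fun ω => g (Function.update ω e₁ true)) e₂,
    expect_eq_pin p (fun ω => g (Function.update ω e₁ false)) e₂,
    expect_update_one, expect_update_zero, expect_update_one, expect_update_zero]
  simp only [upd]
  ring

variable {o}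

omit [Fintype E] [Fintype V] [DecidableEq V] [LinearOrder R] [IsStrictOrderedRing R] in
/-- Indicator invariance for `upd true false`. -/
lemma ind_upd_tf (h : IsTwoRootAt ends a₁ a₂ a₃ e₁ e₂) {u v : V} (hu : u ≠ a₃) (hv : v ≠ a₃)
    (ω : Config E) : (connEvent ends u v).indicator (1 : Config E → R) (upd e₁ e₂ true false ω) =
      (connEvent ends u v).indicator 1 (base e₁ e₂ ω) := by
  by_cases hc : Conn ends (base e₁ e₂ ω) u v
  · rw [Set.indicator_of_mem (show base e₁ e₂ ω ∈ connEvent ends u v from hc),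
      Set.indicator_of_mem (show upd e₁ e₂ true false ω ∈ connEvent ends u v from
        (conn_upd_tf h ω hu hv).2 hc)]
    rfl
  · rw [Set.indicator_of_notMem (show base e₁ e₂ ω ∉ connEvent ends u v from hc),
      Set.indicator_of_notMem (show upd e₁ e₂ true false ω ∉ connEvent ends u v from
        fun h' => hc ((conn_upd_tf h ω hu hv).1 h'))]

omit [Fintype E] [Fintype V] [DecidableEq V] [LinearOrder R] [IsStrictOrderedRing R] in
/-- Indicator invariance for `upd false true`. -/
lemma ind_upd_ft (h : IsTwoRootAt ends a₁ a₂ a₃ e₁ e₂) {u v : V} (hu : u ≠ a₃) (hv : v ≠ a₃)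
    (ω : Config E) : (connEvent ends u v).indicator (1 : Config E → R) (upd e₁ e₂ false true ω) =
      (connEvent ends u v).indicator 1 (base e₁ e₂ ω) := by
  by_cases hc : Conn ends (base e₁ e₂ ω) u v
  · rw [Set.indicator_of_mem (show base e₁ e₂ ω ∈ connEvent ends u v from hc),
      Set.indicator_of_mem (show upd e₁ e₂ false true ω ∈ connEvent ends u v from
        (conn_upd_ft h ω hu hv).2 hc)]
    rfl
  · rw [Set.indicator_of_notMem (show base e₁ e₂ ω ∉ connEvent ends u v from hc),
      Set.indicator_of_notMem (show upd e₁ e₂ false true ω ∉ connEvent ends u v from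
        fun h' => hc ((conn_upd_ft h ω hu hv).1 h'))]

omit [Fintype E] [DecidableEq E] [Fintype V] [DecidableEq V] [LinearOrder R] [IsStrictOrderedRing R] in
/-- `Q` as a connection-event complement: `𝟙Q = 1 − 1[a₂ ↔ a₁]`. -/
lemma indQ_eq (ω : Config E) :
    𝟙Q ω = 1 - (connEvent ends a₂ a₁).indicator (1 : Config E → R) ω := by
  by_cases hc : Conn ends ω a₂ a₁
  · rw [Set.indicator_of_mem (show ω ∈ connEvent ends a₂ a₁ from hc),
      Set.indicator_of_notMem (show ω ∉ Q from fun hQ => hQ a₁ (Finset.mem_singleton_self _) hc)]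
    simp
  · rw [Set.indicator_of_notMem (show ω ∉ connEvent ends a₂ a₁ from hc),
      Set.indicator_of_mem (show ω ∈ Q from fun x hx => by
        rw [Finset.mem_singleton] at hx; subst hx; exact hc)]
    simp

omit [Fintype E] [Fintype V] [DecidableEq V] [LinearOrder R] [IsStrictOrderedRing R] in
/-- `Q` vanishes when both root edges are open. -/
lemma indQ_upd_tt (h : IsTwoRootAt ends a₁ a₂ a₃ e₁ e₂) (ω : Config E) :
    𝟙Q (upd e₁ e₂ true true ω) = 0 := by
  rw [indQ_eq, Set.indicator_of_mem (show upd e₁ e₂ true true ω ∈ connEvent ends a₂ a₁ from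
    conn_symm (conn_upd_tt h ω))]
  simp

omit [Fintype E] [Fintype V] [DecidableEq V] [LinearOrder R] [IsStrictOrderedRing R] in
/-- `𝟙Q` ignores the root edges (off `(open, open)`). -/
lemma indQ_upd_tf (h : IsTwoRootAt ends a₁ a₂ a₃ e₁ e₂) (ω : Config E) :
    𝟙Q (upd e₁ e₂ true false ω) = 𝟙Q (base e₁ e₂ ω) := by
  rw [indQ_eq, indQ_eq, ind_upd_tf h h.ne₂ h.ne₁]

omit [Fintype E] [Fintype V] [DecidableEq V] [LinearOrder R] [IsStrictOrderedRing R] in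
/-- `𝟙Q` ignores the root edges (off `(open, open)`). -/
lemma indQ_upd_ft (h : IsTwoRootAt ends a₁ a₂ a₃ e₁ e₂) (ω : Config E) :
    𝟙Q (upd e₁ e₂ false true ω) = 𝟙Q (base e₁ e₂ ω) := by
  rw [indQ_eq, indQ_eq, ind_upd_ft h h.ne₂ h.ne₁]

omit [Fintype E] [Fintype V] [DecidableEq V] in
/-- Membership in `Q` ignores the root edges (`upd false true`). -/
lemma mem_Q_upd_ft (h : IsTwoRootAt ends a₁ a₂ a₃ e₁ e₂) (ω : Config E) :
    upd e₁ e₂ false true ω ∈ Q ↔ base e₁ e₂ ω ∈ Q := by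
  simp only [mem_avoidAll, Finset.mem_singleton, forall_eq]
  rw [conn_upd_ft h ω h.ne₂ h.ne₁]

omit [Fintype E] [Fintype V] [DecidableEq V] in
/-- On `Q`, the cluster of `a₁` in `upd false true ω` is that of the base configuration. -/
lemma cluster_upd_ft (h : IsTwoRootAt ends a₁ a₂ a₃ e₁ e₂) (ω : Config E)
    (hQ : upd e₁ e₂ false true ω ∈ Q) :
    cluster ends (upd e₁ e₂ false true ω) a₁ = cluster ends (base e₁ e₂ ω) a₁ := by
  ext v
  simp only [mem_cluster]
  by_cases hv : v = a₃
  · rw [hv]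
    constructor
    · intro hc
      exact absurd (conn_symm (conn_a₁a₂_of_upd_ft h ω hc)) (hQ a₁ (Finset.mem_singleton_self _))
    · intro hc
      exact absurd (eq_of_conn_base h ω (conn_symm hc)) h.ne₁
  · exact conn_upd_ft h ω h.ne₁ hv

omit [Fintype E] [Fintype V] [DecidableEq V] [LinearOrder R] [IsStrictOrderedRing R] in
/-- `𝟙e` is `1` on `upd true false`, and `𝟙e · 𝟙Q` vanishes on `upd false true` and on the base. -/
lemma inde_upd_tf (h : IsTwoRootAt ends a₁ a₂ a₃ e₁ e₂) (ω : Config E) :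
    𝟙e (upd e₁ e₂ true false ω) = 1 := by
  rw [Set.indicator_of_mem (show upd e₁ e₂ true false ω ∈ connEvent ends a₁ a₃ from
    conn_upd_tf_a₁a₃ h ω)]
  rfl

omit [Fintype E] [Fintype V] [DecidableEq V] [LinearOrder R] [IsStrictOrderedRing R] in
/-- `𝟙e · 𝟙Q` vanishes on `upd false true`. -/
lemma inde_indQ_upd_ft (h : IsTwoRootAt ends a₁ a₂ a₃ e₁ e₂) (ω : Config E) :
    𝟙e (upd e₁ e₂ false true ω) * 𝟙Q (upd e₁ e₂ false true ω) = 0 := by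
  by_cases hQ : upd e₁ e₂ false true ω ∈ Q
  · rw [Set.indicator_of_notMem (show upd e₁ e₂ false true ω ∉ connEvent ends a₁ a₃ from
      fun hc => hQ a₁ (Finset.mem_singleton_self _) (conn_symm (conn_a₁a₂_of_upd_ft h ω hc)))]
    simp
  · rw [Set.indicator_of_notMem hQ]
    simp

omit [Fintype E] [Fintype V] [DecidableEq V] [LinearOrder R] [IsStrictOrderedRing R] in
/-- `𝟙e` vanishes on the base configuration. -/
lemma inde_base (h : IsTwoRootAt ends a₁ a₂ a₃ e₁ e₂) (ω : Config E) :
    𝟙e (base e₁ e₂ ω) = 0 := by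
  rw [Set.indicator_of_notMem (show base e₁ e₂ ω ∉ connEvent ends a₁ a₃ from
    fun hc => h.ne₁ (eq_of_conn_base h ω (conn_symm hc)))]

end TwoRoot

end SLevel

end Summit.Ventures.PercRepro2
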